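import Literature.NumberTheory.GaloisRepresentations.SemiLocalUnitGroupShapiro
import Literature.NumberTheory.GaloisRepresentations.LocalCyclicLayerClassModule
import Literature.NumberTheory.Automorphic.AdicCompletionDegreeOnePlaceProofs
import Mathlib.RepresentationTheory.Homological.GroupCohomology.LongExactSequence
import HarnessLib

/-!
# `0 → 𝒪_wˣ → E_wˣ → ℤ → 0` as Galois modules and `H¹(K, 𝒪_wˣ) = 0` for every `K ≤ Gal(E_w/F_v)`
# at an unramified place; hence `H¹(Gal(E/F), ∏_{w ∣ v} 𝒪_wˣ) = 0` (Harari §13.1 / Prop. 8.3; Serre XII §3)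

Topic `NumberTheory/GaloisRepresentations`; namespaces `Literature.NumberTheory.GaloisRepresentations.RepSES`
(§0, generic) and `….SemiLocal`, continuing `SemiLocalUnitGroupShapiro.lean` (`placeUnitGroupRep w` =
`𝒪_wˣ` as a `Gal(E_w/F_v)`-module, `unitGroupRep F E v = ∏_{w∣v} 𝒪_wˣ`, Shapiro
`groupCohomologyUnitGroupRepIsoAut`, the transfer `isZero_groupCohomology_unitGroupRep_of_isZero`).
Definitions with bodies (the valuation morphism and the short complex) and theorems; NO named fact, no
`sorry`, no instance, no notation; number fields in `Type`.

Mathematics.  For a finite Galois extension of number fields `E/F`, a finite place `v` of `F` and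
`w ∣ v`, the valuation gives a short exact sequence of `Gal(E_w/F_v)`-modules
`0 → 𝒪_wˣ → E_wˣ → ℤ → 0` (trivial action on `ℤ`: the automorphisms are isometries,
`valued_algEquiv_place`).  For a subgroup `K`, the long exact sequence reads
`(E_wˣ)^K → ℤ → H¹(K, 𝒪_wˣ) → H¹(K, E_wˣ) = 0` (Hilbert 90 for `E_w/E_w^K`, the tree's
`UnitsLayer.isZero_H1_res_units`); if `e(w|v) = 1` a uniformiser of `F_v` is a uniformiser of `E_w`
fixed by every `K`, so `(E_wˣ)^K → ℤ` is onto and **`H¹(K, 𝒪_wˣ) = 0`**.  This is the degree-one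
half of "the units of an unramified extension are cohomologically trivial" (Harari Prop. 8.3; Serre,
*Local Fields* XII §3: Lemma 2 "`H^q(𝔤, U_L^1) = 0`" and "`H^q(𝔤, U_L) = H^q(𝔤, L̄^*) = H^q(L̄/K̄), q ≥ 1`"), the other half being `Ĥ⁰(K, 𝒪_wˣ) = 0` (units are norms; the
tree's `SemiLocal.exists_unitGroup_norm_eq_of_isUnramifiedIn` in semi-local form) — together they
feed the engine's criterion `CohomologicalTriviality.isCohomologicallyTrivial_of_isZero_tateCohomology`
(`q₀ = 0`), whence Harari's "`Ĥ^i(G, U_K(v)) = Ĥ^i(G_v, U_{K,v}) = 0`" by the Shapiro file.  Here: the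
sequence, the `H¹` half for every subgroup, and the consequences `H¹(G_w, 𝒪_wˣ) = 0`,
`H¹(Gal(E/F), ∏_{w∣v} 𝒪_wˣ) = 0`.

## What is formalised

* §0 (`RepSES`, any commutative ring `k`, any group): `shortExact_of_apply` (a short complex in
  `Rep k G` that is injective/exact/surjective on elements is short exact — as in
  `Automorphic/IdeleGaloisRep.lean`, there private), `shortExact_map_res` (the same after `Rep.res`),
  and **`isZero_H1_of_isZero_H1_of_surjective_invariants`**: for a short exact `0 → X₁ → X₂ → X₃ → 0`
  with `H¹(G, X₂) = 0` and `X₂^G → X₃^G` onto, `H¹(G, X₁) = 0` (Mathlib's long exact sequence: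
  `epi_δ_of_isZero`, `mapShortComplex₃`, `map_id_comp_H0Iso_hom`).
* §1 the valuation `unitsVal w : Additive E_wˣ →ₗ[ℤ] ℤ` (`u ↦ log v_w(u)`, Mathlib `WithZero.log`),
  `exp_unitsVal`, `unitsVal_eq_zero_iff` (kernel = `placeUnitGroup w`), `unitsVal_smul` (invariance),
  `exists_unitsVal_eq` (onto: a uniformiser of `E`), the morphism
  `unitsValRepHom w : Rep.ofAlgebraAutOnUnits F_v E_w ⟶ Rep.trivial ℤ Gal(E_w/F_v) ℤ`.
* §2 **`placeUnitsShortComplex w`** = `0 → 𝒪_wˣ → E_wˣ → ℤ → 0` in `Rep ℤ Gal(E_w/F_v)` and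
  `placeUnitsShortComplex_shortExact`, `…_res_shortExact` (restricted to any `K`).
* §3 at `e(w|v) = 1`: `exists_invariant_unitsVal_eq` (a uniformiser of `F_v` is an invariant unit of
  valuation `-1` in `E_w`, tree `valued_adicCompletionOfLiesOver_of_ramificationIdx_eq_one`), and the
  vanishing theorems **`isZero_H1_res_placeUnitGroupRep`** (`H¹(K, 𝒪_wˣ) = 0` for every
  `K ≤ Gal(E_w/F_v)`), `isZero_H1_placeUnitGroupRep`, `isZero_H1_localIntUnitsRep` (`G_w` form),
  **`isZero_H1_unitGroupRep`** (`H¹(Gal(E/F), ∏_{w∣v} 𝒪_wˣ) = 0`, via Shapiro).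

Not here: `Ĥ⁰(K, 𝒪_wˣ) = 0` for the subgroups `K` (needs the semi-local norm theorem of
`UnramifiedLocalNorms.lean` after the base change `E/E^K`, next file), hence full cohomological
triviality and the higher `Hⁿ`.

## References
* D. Harari, *Galois Cohomology and Class Field Theory*, Springer (2020), Prop. 8.3 and §13.1 (proof of
  Prop. 13.1 (b)). [Harari2020]
* J.-P. Serre, *Local Fields*, GTM 67 (1979), Ch. XII §3 (Lemma 2; the split sequence "`0 → U_L → L^* → Z → 0`"
  for unramified `L/K` — "choosing a uniformizer of K allows the identification of `L^*` with `U_L × Z` as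
  𝔤-modules"; "`H^q(𝔤, U_L) = H^q(L̄/K̄), q ≥ 1`"), Ch. X §1 Prop. 2 (Hilbert 90). [SerreLocalFields1979]
* J. W. S. Cassels, A. Fröhlich (eds.), *Algebraic Number Theory* (1967), Ch. VII (Tate) §7.3.
  [CasselsFrohlichANT1967]
-/

noncomputable section

open NumberField IsDedekindDomain CategoryTheory CategoryTheory.Limits groupCohomology
open Literature.NumberTheory.Automorphic

namespace Literature.NumberTheory.GaloisRepresentations

/-! ## §0. Short exact sequences of representations and the vanishing of `H¹` -/

namespace RepSES

universe u

variable {k G : Type u} [CommRing k] [Group G]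

/-- A short complex of representations that is injective / exact / surjective on elements is short
exact (exactness reflected by the faithful forgetful functor to `k`-modules).
[cite: SerreLocalFields1979, Ch. VII §2 (exact sequences of `G`-modules)] -/
theorem shortExact_of_apply (S : ShortComplex (Rep.{u} k G))
    (hinj : Function.Injective S.f.hom) (hsurj : Function.Surjective S.g.hom)
    (hex : ∀ x, S.g.hom x = 0 → ∃ y, S.f.hom y = x) : S.ShortExact where
  exact := by
    apply (forget₂ (Rep k G) (ModuleCat k)).reflects_exact_of_faithful
    rw [ShortComplex.moduleCat_exact_iff]
    exact hex
  mono_f := (Rep.mono_iff_injective _).2 hinj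
  epi_g := (Rep.epi_iff_surjective _).2 hsurj

/-- Restriction along a group homomorphism keeps an element-wise short exact sequence short exact
(the underlying maps are the same). [cite: SerreLocalFields1979, Ch. VII §2 (exact sequences of `G`-modules)] -/
theorem shortExact_map_res {H : Type u} [Group H] (f : H →* G) (S : ShortComplex (Rep.{u} k G))
    (hinj : Function.Injective S.f.hom) (hsurj : Function.Surjective S.g.hom)
    (hex : ∀ x, S.g.hom x = 0 → ∃ y, S.f.hom y = x) : (S.map (Rep.resFunctor f)).ShortExact :=
  shortExact_of_apply _ hinj hsurj hex

/-- **`H¹(G, X₁) = 0` from `0 → X₁ → X₂ → X₃ → 0` with `H¹(G, X₂) = 0` and `X₂^G → X₃^G` onto**: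
in `X₂^G → X₃^G → H¹(X₁) → H¹(X₂) = 0` the connecting map `δ` is onto (`epi_δ_of_isZero`) and
zero (the first map is epi: Mathlib `H0Iso` + `map_id_comp_H0Iso_hom` + surjectivity on invariants).
[cite: SerreLocalFields1979, Ch. VII §2 (long exact cohomology sequence)] -/
theorem isZero_H1_of_isZero_H1_of_surjective_invariants {S : ShortComplex (Rep.{u} k G)} (hS : S.ShortExact)
    (h2 : IsZero (groupCohomology S.X₂ 1))
    (h0 : ∀ z ∈ S.X₃.ρ.invariants, ∃ y ∈ S.X₂.ρ.invariants, S.g.hom y = z) :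
    IsZero (groupCohomology S.X₁ 1) := by
  -- `δ : H⁰(X₃) → H¹(X₁)` is onto since `H¹(X₂) = 0`
  haveI hepi : Epi (δ hS 0 1 rfl) := epi_δ_of_isZero hS 0 h2
  -- `H⁰(X₂) → H⁰(X₃)` is onto
  haveI hepi0 : Epi (map (MonoidHom.id G) S.g 0) := by
    have hsurj : Function.Surjective ((Rep.invariantsFunctor k G).map S.g) := by
      rintro ⟨z, hz⟩
      obtain ⟨y, hy, hyz⟩ := h0 z hz
      exact ⟨⟨y, hy⟩, Subtype.ext hyz⟩
    haveI : Epi ((Rep.invariantsFunctor k G).map S.g) := (ModuleCat.epi_iff_surjective _).mpr hsurj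
    have heq : map (MonoidHom.id G) S.g 0 =
        (H0Iso S.X₂).hom ≫ (Rep.invariantsFunctor k G).map S.g ≫ (H0Iso S.X₃).inv := by
      rw [← Category.assoc, ← map_id_comp_H0Iso_hom, Category.assoc, Iso.hom_inv_id, Category.comp_id]
    rw [heq]
    infer_instance
  -- hence `δ = 0`, and an epimorphism which is zero has zero target
  have hδ : δ hS 0 1 rfl = 0 := by
    have h := (mapShortComplex₃ hS (rfl : 0 + 1 = 1)).zero
    exact zero_of_epi_comp (map (MonoidHom.id G) S.g 0) h
  rw [IsZero.iff_id_eq_zero, ← cancel_epi (δ hS 0 1 rfl), hδ, zero_comp, zero_comp]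

end RepSES

namespace SemiLocal

open Literature.Algebra.Homology

variable {F : Type} [Field F] [NumberField F] {E : Type} [Field E] [NumberField E] [Algebra F E]
variable {v : HeightOneSpectrum (𝓞 F)}

/-! ## §1. The valuation `E_wˣ → ℤ`, additively, as a morphism of representations -/

omit [NumberField F] in
/-- A unit of `E_w` has non-zero valuation. [cite: SerreLocalFields1979, Ch. XII §3 (the sequence `0 → U_L → L^* → ℤ → 0`)] -/
theorem valued_units_ne_zero (w : Place F E v) (u : ((w : HeightOneSpectrum (𝓞 E)).adicCompletion E)ˣ) :
    Valued.v (u : (w : HeightOneSpectrum (𝓞 E)).adicCompletion E) ≠ 0 :=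
  (Valuation.ne_zero_iff _).mpr u.ne_zero

/-- **The valuation on `E_wˣ`, additively**: `u ↦ log v_w(u) ∈ ℤ` (`v_w(u) = exp(log v_w(u))`), a
`ℤ`-linear map on `Additive E_wˣ`. [cite: SerreLocalFields1979, Ch. XII §3 (the sequence `0 → U_L → L^* → ℤ → 0`)] -/
def unitsVal (w : Place F E v) : Additive ((w : HeightOneSpectrum (𝓞 E)).adicCompletion E)ˣ →ₗ[ℤ] ℤ :=
  AddMonoidHom.toIntLinearMap
    { toFun := fun x => WithZero.log (Valued.v ((Additive.toMul x :
        ((w : HeightOneSpectrum (𝓞 E)).adicCompletion E)ˣ) : (w : HeightOneSpectrum (𝓞 E)).adicCompletion E))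
      map_zero' := by simp
      map_add' := fun x y => by
        rw [toMul_add, Units.val_mul, map_mul, WithZero.log_mul (valued_units_ne_zero w _) (valued_units_ne_zero w _)] }

omit [NumberField F] in
/-- Unfolding `unitsVal`. [cite: SerreLocalFields1979, Ch. XII §3] -/
theorem unitsVal_apply (w : Place F E v) (x : Additive ((w : HeightOneSpectrum (𝓞 E)).adicCompletion E)ˣ) :
    unitsVal w x = WithZero.log (Valued.v ((Additive.toMul x :
        ((w : HeightOneSpectrum (𝓞 E)).adicCompletion E)ˣ) : (w : HeightOneSpectrum (𝓞 E)).adicCompletion E)) := rfl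

omit [NumberField F] in
/-- `exp (unitsVal w u) = v_w(u)`. [cite: SerreLocalFields1979, Ch. XII §3] -/
theorem exp_unitsVal (w : Place F E v) (x : Additive ((w : HeightOneSpectrum (𝓞 E)).adicCompletion E)ˣ) :
    WithZero.exp (unitsVal w x) = Valued.v ((Additive.toMul x :
        ((w : HeightOneSpectrum (𝓞 E)).adicCompletion E)ˣ) : (w : HeightOneSpectrum (𝓞 E)).adicCompletion E) := by
  rw [unitsVal_apply, WithZero.exp_log (valued_units_ne_zero w _)]

omit [NumberField F] in
/-- **The kernel of the valuation is `𝒪_wˣ`.** [cite: SerreLocalFields1979, Ch. XII §3] -/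
theorem unitsVal_eq_zero_iff (w : Place F E v) (x : Additive ((w : HeightOneSpectrum (𝓞 E)).adicCompletion E)ˣ) :
    unitsVal w x = 0 ↔ (Additive.toMul x : ((w : HeightOneSpectrum (𝓞 E)).adicCompletion E)ˣ) ∈ placeUnitGroup w := by
  rw [mem_placeUnitGroup_iff, ← exp_unitsVal, ← WithZero.exp_zero, WithZero.exp_inj]

/-- **The valuation is `Gal(E_w/F_v)`-invariant** (`E/F` Galois: the automorphisms are isometries,
`valued_algEquiv_place`). [cite: CasselsFrohlichANT1967, Ch. VII §1.1] -/
theorem unitsVal_smul [IsGalois F E] (w : Place F E v)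
    (σ : (w : HeightOneSpectrum (𝓞 E)).adicCompletion E ≃ₐ[v.adicCompletion F]
      (w : HeightOneSpectrum (𝓞 E)).adicCompletion E)
    (x : Additive ((w : HeightOneSpectrum (𝓞 E)).adicCompletion E)ˣ) :
    unitsVal w (Representation.ofMulDistribMulAction
      ((w : HeightOneSpectrum (𝓞 E)).adicCompletion E ≃ₐ[v.adicCompletion F]
        (w : HeightOneSpectrum (𝓞 E)).adicCompletion E)
      ((w : HeightOneSpectrum (𝓞 E)).adicCompletion E)ˣ σ x) = unitsVal w x := by
  rw [unitsVal_apply, unitsVal_apply]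
  change WithZero.log (Valued.v (σ _)) = _
  rw [valued_algEquiv_place]

/-- **The valuation as a morphism `E_wˣ ⟶ ℤ` of representations** (`ℤ` with trivial action).
[cite: SerreLocalFields1979, Ch. XII §3] -/
def unitsValRepHom [IsGalois F E] (w : Place F E v) :
    Rep.ofAlgebraAutOnUnits (v.adicCompletion F) ((w : HeightOneSpectrum (𝓞 E)).adicCompletion E) ⟶
      Rep.trivial ℤ ((w : HeightOneSpectrum (𝓞 E)).adicCompletion E ≃ₐ[v.adicCompletion F]
        (w : HeightOneSpectrum (𝓞 E)).adicCompletion E) ℤ :=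
  Rep.ofHom ⟨unitsVal w, fun σ => LinearMap.ext fun x => by
    rw [LinearMap.comp_apply, unitsVal_smul]
    rfl⟩

/-- `unitsValRepHom` is `unitsVal` on elements. [cite: SerreLocalFields1979, Ch. XII §3] -/
theorem unitsValRepHom_hom_apply [IsGalois F E] (w : Place F E v)
    (x : Additive ((w : HeightOneSpectrum (𝓞 E)).adicCompletion E)ˣ) :
    (unitsValRepHom w).hom x = unitsVal w x := rfl

omit [NumberField F] in
/-- **The valuation `E_wˣ → ℤ` is onto** (a uniformiser of `E` at `w`, Mathlib
`valuation_exists_uniformizer`, and its powers). [cite: SerreLocalFields1979, Ch. XII §3] -/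
theorem exists_unitsVal_eq (w : Place F E v) (z : ℤ) :
    ∃ x : Additive ((w : HeightOneSpectrum (𝓞 E)).adicCompletion E)ˣ, unitsVal w x = z := by
  obtain ⟨π, hπ⟩ := (w : HeightOneSpectrum (𝓞 E)).valuation_exists_uniformizer E
  have hπ0 : (π : (w : HeightOneSpectrum (𝓞 E)).adicCompletion E) ≠ 0 := by
    intro h
    have := congrArg Valued.v h
    rw [HeightOneSpectrum.adicCompletion.valued_coe, hπ, map_zero] at this
    exact WithZero.exp_ne_zero this
  refine ⟨Additive.ofMul ((Units.mk0 _ hπ0) ^ (-z)), ?_⟩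
  rw [unitsVal_apply, toMul_ofMul, Units.val_zpow_eq_zpow_val, Units.val_mk0, map_zpow₀,
    HeightOneSpectrum.adicCompletion.valued_coe, hπ, WithZero.log_zpow, WithZero.log_exp]
  ring

/-! ## §2. The short exact sequence `0 → 𝒪_wˣ → E_wˣ → ℤ → 0` -/

/-- **`0 → 𝒪_wˣ → E_wˣ → ℤ → 0` as a short complex in `Rep ℤ Gal(E_w/F_v)`** (the composite is zero:
units of `𝒪_w` have valuation `1`). [cite: SerreLocalFields1979, Ch. XII §3] -/
def placeUnitsShortComplex [IsGalois F E] (w : Place F E v) :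
    ShortComplex (Rep.{0} ℤ ((w : HeightOneSpectrum (𝓞 E)).adicCompletion E ≃ₐ[v.adicCompletion F]
      (w : HeightOneSpectrum (𝓞 E)).adicCompletion E)) :=
  ShortComplex.mk (placeUnitGroupRepHom w) (unitsValRepHom w) (by
    refine Rep.hom_ext (Representation.IntertwiningMap.ext (LinearMap.ext fun x => ?_))
    change unitsVal w (Additive.ofMul ((Additive.toMul x : placeUnitGroup w) :
      ((w : HeightOneSpectrum (𝓞 E)).adicCompletion E)ˣ)) = 0
    rw [unitsVal_eq_zero_iff, toMul_ofMul]
    exact (Additive.toMul x : placeUnitGroup w).2)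

/-- `𝒪_wˣ → E_wˣ` is injective. [cite: SerreLocalFields1979, Ch. XII §3] -/
theorem placeUnitsShortComplex_injective [IsGalois F E] (w : Place F E v) :
    Function.Injective (placeUnitsShortComplex w).f.hom :=
  fun _ _ h => Additive.toMul.injective (Subtype.ext (congrArg Additive.toMul h))

/-- `E_wˣ → ℤ` is surjective. [cite: SerreLocalFields1979, Ch. XII §3] -/
theorem placeUnitsShortComplex_surjective [IsGalois F E] (w : Place F E v) :
    Function.Surjective (placeUnitsShortComplex w).g.hom := fun z =>
  exists_unitsVal_eq w z

/-- Exactness in the middle: valuation zero means a unit of `𝒪_w`. [cite: SerreLocalFields1979, Ch. XII §3] -/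
theorem placeUnitsShortComplex_exact_apply [IsGalois F E] (w : Place F E v)
    (x : Additive ((w : HeightOneSpectrum (𝓞 E)).adicCompletion E)ˣ) (hx : (placeUnitsShortComplex w).g.hom x = 0) :
    ∃ y, (placeUnitsShortComplex w).f.hom y = x :=
  ⟨Additive.ofMul ⟨Additive.toMul x, (unitsVal_eq_zero_iff w x).mp hx⟩, rfl⟩

/-- **`0 → 𝒪_wˣ → E_wˣ → ℤ → 0` is short exact in `Rep ℤ Gal(E_w/F_v)`.**
[cite: SerreLocalFields1979, Ch. XII §3] -/
theorem placeUnitsShortComplex_shortExact [IsGalois F E] (w : Place F E v) :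
    (placeUnitsShortComplex w).ShortExact :=
  RepSES.shortExact_of_apply _ (placeUnitsShortComplex_injective w) (placeUnitsShortComplex_surjective w)
    (placeUnitsShortComplex_exact_apply w)

/-- The same sequence restricted to a subgroup `K ≤ Gal(E_w/F_v)` is short exact.
[cite: SerreLocalFields1979, Ch. XII §3] -/
theorem placeUnitsShortComplex_res_shortExact [IsGalois F E] (w : Place F E v)
    (K : Subgroup ((w : HeightOneSpectrum (𝓞 E)).adicCompletion E ≃ₐ[v.adicCompletion F]
      (w : HeightOneSpectrum (𝓞 E)).adicCompletion E)) :
    ((placeUnitsShortComplex w).map (Rep.resFunctor K.subtype)).ShortExact :=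
  RepSES.shortExact_map_res K.subtype _ (placeUnitsShortComplex_injective w)
    (placeUnitsShortComplex_surjective w) (placeUnitsShortComplex_exact_apply w)

/-! ## §3. Unramified places: invariant uniformisers and `H¹(K, 𝒪_wˣ) = 0` -/

/-- **At `e(w|v) = 1` a uniformiser of `F_v` is a uniformiser of `E_w`**, fixed by every
`F_v`-automorphism: every integer is the valuation of a `Gal(E_w/F_v)`-invariant unit of `E_w`
(tree `valued_adicCompletionOfLiesOver_of_ramificationIdx_eq_one`, Mathlib `valuation_exists_uniformizer`).
[cite: SerreLocalFields1979, Ch. XII §3 (the split sequence 0 → U_L → L^* → Z → 0)] -/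
theorem exists_invariant_unitsVal_eq [IsGalois F E] (w : Place F E v)
    (he : (w : HeightOneSpectrum (𝓞 E)).asIdeal.ramificationIdx (𝓞 F) = 1) (z : ℤ) :
    ∃ x : Additive ((w : HeightOneSpectrum (𝓞 E)).adicCompletion E)ˣ,
      (∀ σ : (w : HeightOneSpectrum (𝓞 E)).adicCompletion E ≃ₐ[v.adicCompletion F]
        (w : HeightOneSpectrum (𝓞 E)).adicCompletion E,
        Representation.ofMulDistribMulAction
          ((w : HeightOneSpectrum (𝓞 E)).adicCompletion E ≃ₐ[v.adicCompletion F]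
            (w : HeightOneSpectrum (𝓞 E)).adicCompletion E)
          ((w : HeightOneSpectrum (𝓞 E)).adicCompletion E)ˣ σ x = x) ∧
      unitsVal w x = z := by
  obtain ⟨π, hπ⟩ := v.valuation_exists_uniformizer F
  set πw : (w : HeightOneSpectrum (𝓞 E)).adicCompletion E :=
    algebraMap (v.adicCompletion F) _ (π : v.adicCompletion F) with hπw_def
  have hvπw : Valued.v πw = WithZero.exp (-1 : ℤ) := by
    rw [hπw_def, algebraMap_place_eq, valued_adicCompletionOfLiesOver_of_ramificationIdx_eq_one F E v _ he,
      HeightOneSpectrum.adicCompletion.valued_coe, hπ]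
  have hπ0 : πw ≠ 0 := by
    intro h
    have := congrArg Valued.v h
    rw [hvπw, map_zero] at this
    exact WithZero.exp_ne_zero this
  refine ⟨Additive.ofMul ((Units.mk0 _ hπ0) ^ (-z)), fun σ => ?_, ?_⟩
  · apply Additive.toMul.injective
    refine Units.ext ?_
    change σ (((Units.mk0 πw hπ0 ^ (-z) : ((w : HeightOneSpectrum (𝓞 E)).adicCompletion E)ˣ) :
      (w : HeightOneSpectrum (𝓞 E)).adicCompletion E)) =
      ((Units.mk0 πw hπ0 ^ (-z) : ((w : HeightOneSpectrum (𝓞 E)).adicCompletion E)ˣ) :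
        (w : HeightOneSpectrum (𝓞 E)).adicCompletion E)
    rw [Units.val_zpow_eq_zpow_val, Units.val_mk0, map_zpow₀, hπw_def, AlgEquiv.commutes]
  · rw [unitsVal_apply, toMul_ofMul, Units.val_zpow_eq_zpow_val, Units.val_mk0, map_zpow₀, hvπw,
      WithZero.log_zpow, WithZero.log_exp]
    ring

/-- **`H¹(K, 𝒪_wˣ) = 0` for every subgroup `K ≤ Gal(E_w/F_v)`, at a place with `e(w|v) = 1`** —
`(E_wˣ)^K → ℤ → H¹(K, 𝒪_wˣ) → H¹(K, E_wˣ) = 0` with the first map onto (the invariant uniformiser) and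
Hilbert 90 for `E_w/E_w^K` (tree `UnitsLayer.isZero_H1_res_units`).
[cite: Harari2020, Prop. 8.3 and §13.1][cite: SerreLocalFields1979, Ch. XII §3 (H^q(𝔤, U_L) = H^q(L̄/K̄), q ≥ 1)] -/
theorem isZero_H1_res_placeUnitGroupRep [IsGalois F E] (w : Place F E v)
    (he : (w : HeightOneSpectrum (𝓞 E)).asIdeal.ramificationIdx (𝓞 F) = 1)
    (K : Subgroup ((w : HeightOneSpectrum (𝓞 E)).adicCompletion E ≃ₐ[v.adicCompletion F]
      (w : HeightOneSpectrum (𝓞 E)).adicCompletion E)) :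
    IsZero (groupCohomology (Rep.res K.subtype (placeUnitGroupRep w)) 1) := by
  haveI := finiteDimensional_place (K := F) w
  refine RepSES.isZero_H1_of_isZero_H1_of_surjective_invariants (placeUnitsShortComplex_res_shortExact w K)
    (UnitsLayer.isZero_H1_res_units (v.adicCompletion F) _ K) fun z _ => ?_
  obtain ⟨x, hfix, hx⟩ := exists_invariant_unitsVal_eq w he z
  exact ⟨x, fun g => hfix g, hx⟩

/-- **`H¹(Gal(E_w/F_v), 𝒪_wˣ) = 0`** at a place with `e(w|v) = 1`.
[cite: Harari2020, Prop. 8.3][cite: SerreLocalFields1979, Ch. XII §3 (H^q(𝔤, U_L) = H^q(L̄/K̄), q ≥ 1)] -/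
theorem isZero_H1_placeUnitGroupRep [IsGalois F E] (w : Place F E v)
    (he : (w : HeightOneSpectrum (𝓞 E)).asIdeal.ramificationIdx (𝓞 F) = 1) :
    IsZero (groupCohomology (placeUnitGroupRep w) 1) := by
  haveI := finiteDimensional_place (K := F) w
  refine RepSES.isZero_H1_of_isZero_H1_of_surjective_invariants (placeUnitsShortComplex_shortExact w) ?_
    fun z _ => ?_
  · change IsZero (groupCohomology (Rep.ofAlgebraAutOnUnits (v.adicCompletion F)
      ((w : HeightOneSpectrum (𝓞 E)).adicCompletion E)) 1)
    exact @ModuleCat.isZero_of_subsingleton _ _ _ (inferInstance : Subsingleton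
      (groupCohomology.H1 (Rep.ofAlgebraAutOnUnits (v.adicCompletion F)
        ((w : HeightOneSpectrum (𝓞 E)).adicCompletion E))))
  · obtain ⟨x, hfix, hx⟩ := exists_invariant_unitsVal_eq w he z
    exact ⟨x, fun g => hfix g, hx⟩

/-- **`H¹(G_w, 𝒪_wˣ) = 0`** (decomposition-group form) at a place with `e(w|v) = 1`.
[cite: Harari2020, §13.1 (proof of Prop. 13.1 (b))] -/
theorem isZero_H1_localIntUnitsRep [IsGalois F E] (w : Place F E v)
    (he : (w : HeightOneSpectrum (𝓞 E)).asIdeal.ramificationIdx (𝓞 F) = 1) :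
    IsZero (groupCohomology (localIntUnitsRep w) 1) :=
  (isZero_H1_placeUnitGroupRep w he).of_iso (groupCohomologyLocalIntUnitsRepIso w 1)

/-- **`H¹(Gal(E/F), ∏_{w ∣ v} 𝒪_wˣ) = 0`** at a place `v` with `e(w|v) = 1` (Shapiro
`isZero_groupCohomology_unitGroupRep_of_isZero` + `isZero_H1_placeUnitGroupRep`): the degree-one case of
Harari's "`Ĥ^i(G, U_K(v)) = Ĥ^i(G_v, U_{K,v}) = 0`". [cite: Harari2020, §13.1 (proof of Prop. 13.1 (b))] -/
theorem isZero_H1_unitGroupRep [IsGalois F E] (w : Place F E v)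
    (he : (w : HeightOneSpectrum (𝓞 E)).asIdeal.ramificationIdx (𝓞 F) = 1) :
    IsZero (groupCohomology (unitGroupRep F E v) 1) :=
  isZero_groupCohomology_unitGroupRep_of_isZero w 1 (isZero_H1_placeUnitGroupRep w he)

end SemiLocal

end Literature.NumberTheory.GaloisRepresentations

end
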